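import Summits.ResolutionOfSingularities.ResolutionOfSingularities.Theorems.HilbertSamuelEliminationCampaignW42RidgeConfinementHypersurface
import Literature.Barriers.ResolutionOfSingularities.DirectrixSmallCharacteristic
import HarnessLib

/-!
# [OURS · L1 W4.2] Ridge confinement AT THE BARRIER'S WITNESS: the near points of Hironaka's quadric lie in the
# projectivised ridge (and in the directrix of the base-changed cone) — non-vacuity / barrier-compatibility certificate
# for the hypersurface ridge-confinement theorems of slot W4.2 (campaign s42 of cell res-hironaka, LADDER-RESOLUTION
# rung L; informal crux `RidgeConfinement`, stmt-ResolutionOfSingularities-17845; `--supports`, NOT a closing file)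

HONEST FRAMING. Everything below is OURS (campaign mathematics of slot W4.2, prover res-L1-s42-pv-1) over the TREE's
objects: the barrier file `Literature/Barriers/ResolutionOfSingularities/DirectrixSmallCharacteristic.lean` (Hironaka's
quadric `f = X² + λY² + μZ² + λμW²` in characteristic `2`, CJS Ex. 18.30: under `2`-independence `Dir_x(X) = 0`, yet the
`W`-chart of the blow-up of the origin carries a maximal ideal `𝔪 ∋ W` with the strict transform `f' ∈ 𝔪²` — a NEAR
point outside `ℙ(Dir_x X) = ∅`, i.e. CJS Thm. 3.14 fails there) and the hypersurface ridge-confinement theorems of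
`…CampaignW42RidgeConfinementHypersurface.lean`. NOTHING here is a statement of H. Hironaka's manuscript [Hironaka2017];
nothing here asserts that any statement of that manuscript holds or fails. AI review is weaker than expert review.

## What is proved (sorry-free)

* `centreOrder_quadric`, `coordProperTransform_quadric` — the barrier's chart data ARE the tree's proper-transform data:
  `centreOrder univ f = 2` and `coordProperTransform k univ 3 f = f'` (`HironakaQuadric.quadricW`), by the uniqueness
  of the factorisation `π^* f = W² · f'` (`eq_centreOrder_and_eq_coordProperTransform`, `HironakaQuadric.quadric_chartW`).
* **`quadric_residue_mem_ridge`** — at EVERY prime `𝔴 ∋ W` of the `W`-chart with `f' ∈ 𝔴²` (in particular at the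
  barrier's near point `HironakaQuadric.exists_nearPoint`, for every `λ, μ`, `2`-independent or not), the direction
  `(X̄', Ȳ', Z̄', 1) ∈ κ(𝔴)⁴` lies in Giraud's ridge `ridge κ(𝔴) (Ideal.span {f})` of the cone `V(f)` — the slot's
  replacement statement HOLDS exactly where the directrix statement fails (design point (VAC) of
  `…CampaignW42Ridge.lean`: «the statement must hold THERE first»).
* **`quadric_exists_form_eq_aeval`** — the structure theorem there: over `κ(𝔴)` the quadric is a form `G` of degree
  `2` in the three linear forms `X_i − X̄_i·W` (`i = 0, 1, 2`):
  `f ⊗ κ(𝔴) = G(X − X̄'W, Y − Ȳ'W, Z − Z̄'W)` — the near point lies in `ℙ(Dir(C ⊗_k κ(𝔴)))` although `Dir(C) = 0`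
  over `k`: the directrix GROWS under the inseparable residue extension `κ(𝔴)/k`, which is the mechanism behind
  CJS Rem. 18.29 / Ex. 18.30, here certified in the kernel.
* `exists_form_eq_aeval_of_near_residue` — the prime-ideal (scheme-point) packaging of the structure theorem
  `exists_form_eq_aeval_of_near`, used for the above.

References (orientation only): V. Cossart, U. Jannsen, S. Saito, LNM 2270 (2020), Thm. 3.14, Rem. 18.29, Ex. 18.30;
H. Hironaka, Ann. of Math. 92 (1970) (the quadric); J. Giraud, Ann. Sci. ÉNS (4) 8 (1975) §1.5, Cor. 2.4.
-/

noncomputable section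

-- single-conjunct summit: the doubled namespace component `ResolutionOfSingularities` is mandated
set_option linter.dupNamespace false

open MvPolynomial
open Literature.AlgebraicGeometry.Resolution Literature.RingTheory.MvPolynomial
open Literature.Barriers.ResolutionOfSingularities

namespace Summit.ResolutionOfSingularities.ResolutionOfSingularities.Theorems

namespace CampaignW42

universe u v

/-! ## Scheme-point packaging of the structure theorem -/

section Residue

variable {K : Type u} [Field K] {σ : Type v} [DecidableEq σ]

/-- **The structure theorem at every SCHEME POINT of the exceptional fibre**: for a prime `𝔴` of the chart ring
containing `X_j` and the `X_i`, `i ∉ A`, at which the proper transform has order `≥ l` (`∃ s ∉ 𝔴, s·f_𝔙 ∈ 𝔴^l`),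
over the residue field `κ(𝔴)` the degree-`l` component of `f` is a form of degree `l` in the linear forms
`X_i − X̄_i·X_j` (`i ∈ A ∖ j`, `X̄_i` the residue of `X_i`). [folklore] -/
theorem exists_form_eq_aeval_of_near_residue (A : Set σ) {j : σ} (hj : j ∈ A) (f : MvPolynomial σ K)
    (Q : Ideal (MvPolynomial σ K)) [Q.IsPrime] (hQj : (X j : MvPolynomial σ K) ∈ Q)
    (hQ : ∀ i ∉ A, (X i : MvPolynomial σ K) ∈ Q)
    (hnear : ∃ s ∉ Q, s * coordProperTransform K A j f ∈ Q ^ centreOrder A f) :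
    ∃ G : MvPolynomial σ Q.ResidueField, G.IsHomogeneous (centreOrder A f) ∧ fibreRestrict Q.ResidueField A j G = G ∧
      map (algebraMap K Q.ResidueField) (homogeneousComponent (centreOrder A f) f) =
        aeval (fun i => X i - C (algebraMap (MvPolynomial σ K) Q.ResidueField (X i)) * X j) G := by
  set π : MvPolynomial σ K →ₐ[K] Q.ResidueField :=
    IsScalarTower.toAlgHom K (MvPolynomial σ K) Q.ResidueField with hπ
  have hπapp : ∀ p, π p = algebraMap (MvPolynomial σ K) Q.ResidueField p := fun p => rfl
  have hker : RingHom.ker π = Q := by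
    ext p
    rw [RingHom.mem_ker, hπapp, Ideal.algebraMap_residueField_eq_zero]
  obtain ⟨G, hG, hGfix, hFG⟩ := exists_form_eq_aeval_of_near A hj f π
    (by rw [hπapp, Ideal.algebraMap_residueField_eq_zero]; exact hQj)
    (fun i hi => by rw [hπapp, Ideal.algebraMap_residueField_eq_zero]; exact hQ i hi)
    (by
      obtain ⟨s, hs, h⟩ := hnear
      refine ⟨s, ?_, by rwa [hker]⟩
      rw [Ne, hπapp, Ideal.algebraMap_residueField_eq_zero]
      exact hs)
  exact ⟨G, hG, hGfix, hFG⟩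

end Residue

/-! ## Hironaka's quadric: the barrier's chart data are the tree's proper-transform data -/

section Quadric

variable (k : Type u) [Field k]

/-- Distinct squares have distinct exponents. [folklore] -/
theorem single_two_ne {i i' : Fin 4} (h : i ≠ i') :
    (Finsupp.single i 2 : Fin 4 →₀ ℕ) ≠ Finsupp.single i' 2 := by
  rw [Ne, Finsupp.single_left_inj (by norm_num)]
  exact h

/-- The quadric has the monomial `X²` with coefficient `1`. [folklore] -/
theorem coeff_quadric_single_zero (l m : k) :
    coeff (Finsupp.single 0 2) (HironakaQuadric.quadric k l m) = 1 := by
  classical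
  simp only [HironakaQuadric.quadric, coeff_add, coeff_C_mul, coeff_X_pow, if_true,
    if_neg (single_two_ne (by decide : (1 : Fin 4) ≠ 0)), if_neg (single_two_ne (by decide : (2 : Fin 4) ≠ 0)),
    if_neg (single_two_ne (by decide : (3 : Fin 4) ≠ 0)), mul_zero, add_zero]

/-- The quadric is non-zero. [folklore] -/
theorem quadric_ne_zero (l m : k) : HironakaQuadric.quadric k l m ≠ 0 := by
  intro h
  have := coeff_quadric_single_zero k l m
  rw [h, coeff_zero] at this
  exact zero_ne_one this

/-- The strict transform `f'` has the monomial `X'²` with coefficient `1`. [folklore] -/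
theorem coeff_quadricW_single_zero (l m : k) :
    coeff (Finsupp.single 0 2) (HironakaQuadric.quadricW k l m) = 1 := by
  classical
  have h0 : (0 : Fin 4 →₀ ℕ) ≠ Finsupp.single 0 2 := (Finsupp.single_ne_zero.mpr (by norm_num)).symm
  simp only [HironakaQuadric.quadricW, coeff_add, coeff_C_mul, coeff_X_pow, coeff_C, if_true,
    if_neg (single_two_ne (by decide : (1 : Fin 4) ≠ 0)), if_neg (single_two_ne (by decide : (2 : Fin 4) ≠ 0)),
    if_neg h0, mul_zero, add_zero]

/-- `W ∤ f'`: the strict transform is not divisible by the exceptional variable. [folklore] -/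
theorem quadricW_not_mem_span_X (l m : k) :
    HironakaQuadric.quadricW k l m ∉ Ideal.span {(X 3 : MvPolynomial (Fin 4) k)} := by
  intro h
  rw [← Set.image_singleton, mem_ideal_span_X_image] at h
  have hsupp : Finsupp.single (0 : Fin 4) 2 ∈ (HironakaQuadric.quadricW k l m).support := by
    rw [mem_support_iff, coeff_quadricW_single_zero]
    exact one_ne_zero
  obtain ⟨i, hi, hne⟩ := h _ hsupp
  rw [Set.mem_singleton_iff] at hi
  subst hi
  exact hne (Finsupp.single_eq_of_ne (by decide))

/-- The total transform in the `W`-chart, in the tree's coordinates: `π^* f = W² · f'` for Hu's substitution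
`coordBlowupSubst` along the whole variable set, chart `3 = W` (the barrier's `HironakaQuadric.quadric_chartW`).
[folklore] -/
theorem coordBlowupSubst_quadric (l m : k) :
    coordBlowupSubst k (Set.univ : Set (Fin 4)) 3 (HironakaQuadric.quadric k l m) =
      X 3 ^ 2 * HironakaQuadric.quadricW k l m := by
  have h0 : coordBlowupSubst k (Set.univ : Set (Fin 4)) 3 (X 0) = X 3 * X 0 :=
    coordBlowupSubst_X_of_mem_of_ne k Set.univ 3 (Set.mem_univ _) (by decide)
  have h1 : coordBlowupSubst k (Set.univ : Set (Fin 4)) 3 (X 1) = X 3 * X 1 :=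
    coordBlowupSubst_X_of_mem_of_ne k Set.univ 3 (Set.mem_univ _) (by decide)
  have h2 : coordBlowupSubst k (Set.univ : Set (Fin 4)) 3 (X 2) = X 3 * X 2 :=
    coordBlowupSubst_X_of_mem_of_ne k Set.univ 3 (Set.mem_univ _) (by decide)
  have h3 : coordBlowupSubst k (Set.univ : Set (Fin 4)) 3 (X 3) = X 3 := coordBlowupSubst_X_self k Set.univ 3
  simp only [HironakaQuadric.quadric, HironakaQuadric.quadricW, map_add, map_mul, map_pow, coordBlowupSubst_C,
    h0, h1, h2, h3]
  ring

/-- **`ord_D f = ord_0 f = 2`** in the tree's bookkeeping: `centreOrder univ f = 2` for the quadric. [folklore] -/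
theorem centreOrder_quadric (l m : k) :
    centreOrder (Set.univ : Set (Fin 4)) (HironakaQuadric.quadric k l m) = 2 :=
  (eq_centreOrder_and_eq_coordProperTransform k Set.univ 3 (Set.mem_univ _) (quadric_ne_zero k l m)
    (quadricW_not_mem_span_X k l m) (coordBlowupSubst_quadric k l m)).1.symm

/-- **The barrier's strict transform IS the tree's proper transform**: `coordProperTransform k univ 3 f = f'`.
[folklore] -/
theorem coordProperTransform_quadric (l m : k) :
    coordProperTransform k (Set.univ : Set (Fin 4)) 3 (HironakaQuadric.quadric k l m) =
      HironakaQuadric.quadricW k l m :=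
  (eq_centreOrder_and_eq_coordProperTransform k Set.univ 3 (Set.mem_univ _) (quadric_ne_zero k l m)
    (quadricW_not_mem_span_X k l m) (coordBlowupSubst_quadric k l m)).2.symm

/-- The quadric is its own degree-`2` component (the initial form `in_0 f = f`). [folklore] -/
theorem homogeneousComponent_quadric (l m : k) :
    homogeneousComponent (centreOrder (Set.univ : Set (Fin 4)) (HironakaQuadric.quadric k l m))
      (HironakaQuadric.quadric k l m) = HironakaQuadric.quadric k l m := by
  rw [centreOrder_quadric]
  exact homogeneousComponent_eq_self (HironakaQuadric.isHomogeneous_quadric k l m)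

/-! ## Ridge confinement at the barrier's near points -/

/-- **RIDGE CONFINEMENT AT HIRONAKA'S QUADRIC** [OURS · L1 W4.2; barrier-compatibility certificate]. For every field
`k`, every `λ, μ ∈ k`, and EVERY prime `𝔴` of the `W`-chart `k[X', Y', Z', W]` of the blow-up of the origin of
`X = V(X² + λY² + μZ² + λμW²) ⊂ 𝔸⁴` with `W ∈ 𝔴` and `f' ∈ 𝔴²` (a near point of the exceptional divisor, e.g. the
closed point of `HironakaQuadric.exists_nearPoint` in characteristic `2`, which lies OUTSIDE `ℙ(Dir_x X) = ∅` under
`2`-independence), the direction `(X̄', Ȳ', Z̄', 1) ∈ κ(𝔴)⁴` is a `κ(𝔴)`-point of Giraud's ridge of the cone `V(f)`: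
the replacement statement of slot W4.2 holds at the very witness of the barrier
`Literature.Barriers.ResolutionOfSingularities.DirectrixSmallCharacteristic`. [folklore] -/
theorem quadric_residue_mem_ridge (l m : k) (Q : Ideal (MvPolynomial (Fin 4) k)) [Q.IsPrime]
    (hQ3 : (X 3 : MvPolynomial (Fin 4) k) ∈ Q) (hnear : HironakaQuadric.quadricW k l m ∈ Q ^ 2) :
    (fun i => if i = 3 then (1 : Q.ResidueField) else algebraMap (MvPolynomial (Fin 4) k) Q.ResidueField (X i)) ∈
      ridge Q.ResidueField (Ideal.span {HironakaQuadric.quadric k l m}) := by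
  have h := residue_mem_ridge_of_near (K := k) (Set.univ : Set (Fin 4)) (j := 3) (Set.mem_univ _)
    (HironakaQuadric.quadric k l m) Q hQ3 (fun i hi => absurd (Set.mem_univ i) hi)
    ⟨1, fun h1 => Ideal.IsPrime.ne_top' ((Ideal.eq_top_iff_one Q).mpr h1), by
      rw [one_mul, coordProperTransform_quadric, centreOrder_quadric]; exact hnear⟩
  rwa [homogeneousComponent_quadric] at h

/-- In particular, in characteristic `2` the barrier's near point exists and satisfies ridge confinement: there is a
maximal ideal `𝔪 ∋ W` of the `W`-chart with `f' ∈ 𝔪²` (barrier, `HironakaQuadric.exists_nearPoint`) AND the direction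
of every such point lies in the ridge of `V(f)` over its residue field. [folklore] -/
theorem quadric_exists_nearPoint_mem_ridge [CharP k 2] (l m : k) :
    ∃ 𝔪 : Ideal (MvPolynomial (Fin 4) k), ∃ _ : 𝔪.IsMaximal, ∃ _ : 𝔪.IsPrime,
      (X 3 : MvPolynomial (Fin 4) k) ∈ 𝔪 ∧ HironakaQuadric.quadricW k l m ∈ 𝔪 ^ 2 ∧
      ∀ (Q : Ideal (MvPolynomial (Fin 4) k)) [Q.IsPrime], (X 3 : MvPolynomial (Fin 4) k) ∈ Q →
        HironakaQuadric.quadricW k l m ∈ Q ^ 2 →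
        (fun i => if i = 3 then (1 : Q.ResidueField) else algebraMap (MvPolynomial (Fin 4) k) Q.ResidueField (X i)) ∈
          ridge Q.ResidueField (Ideal.span {HironakaQuadric.quadric k l m}) := by
  obtain ⟨𝔪, hmax, h3, hsq⟩ := HironakaQuadric.exists_nearPoint k l m
  exact ⟨𝔪, hmax, hmax.isPrime, h3, hsq, fun Q _ hQ3 hQ => quadric_residue_mem_ridge k l m Q hQ3 hQ⟩

/-- **THE MECHANISM, certified**: at every such near point `𝔴`, over the residue field `κ(𝔴)` the quadric is a form
`G` of degree `2` in the three linear forms `X_i − X̄_i·W` (`i = 0, 1, 2`; `G` involves `X', Y', Z'` only) — the near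
point lies in `ℙ(Dir(V(f) ⊗_k κ(𝔴)))`, a projective PLANE, although `Dir_x(X) = 0` over `k` under `2`-independence:
the directrix grows under the (inseparable) residue extension `κ(𝔴)/k`, the ridge does not (CJS Rem. 18.29, Ex. 18.30).
[folklore] -/
theorem quadric_exists_form_eq_aeval (l m : k) (Q : Ideal (MvPolynomial (Fin 4) k)) [Q.IsPrime]
    (hQ3 : (X 3 : MvPolynomial (Fin 4) k) ∈ Q) (hnear : HironakaQuadric.quadricW k l m ∈ Q ^ 2) :
    ∃ G : MvPolynomial (Fin 4) Q.ResidueField, G.IsHomogeneous 2 ∧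
      fibreRestrict Q.ResidueField (Set.univ : Set (Fin 4)) 3 G = G ∧
      map (algebraMap k Q.ResidueField) (HironakaQuadric.quadric k l m) =
        aeval (fun i => X i - C (algebraMap (MvPolynomial (Fin 4) k) Q.ResidueField (X i)) * X 3) G := by
  have h := exists_form_eq_aeval_of_near_residue (K := k) (Set.univ : Set (Fin 4)) (j := 3) (Set.mem_univ _)
    (HironakaQuadric.quadric k l m) Q hQ3 (fun i hi => absurd (Set.mem_univ i) hi)
    ⟨1, fun h1 => Ideal.IsPrime.ne_top' ((Ideal.eq_top_iff_one Q).mpr h1), by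
      rw [one_mul, coordProperTransform_quadric, centreOrder_quadric]; exact hnear⟩
  rwa [homogeneousComponent_quadric, centreOrder_quadric] at h

end Quadric

end CampaignW42

end Summit.ResolutionOfSingularities.ResolutionOfSingularities.Theorems

end
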